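import Mathlib
import Summits.Langlands.Langlands.Theorems.QuadraticWindowHostInducedRepInducedPackage
import Summits.Langlands.Langlands.Theorems.QuadraticWindowHostInducedRepSignedTwistAux
import Literature.NumberTheory.Automorphic.AsaiSign
import Literature.NumberTheory.Automorphic.WeaklyRegularGaloisRep
import Literature.NumberTheory.Automorphic.BaseChangeInductionAlong
import Literature.NumberTheory.Automorphic.TunnellOctahedralGlobal
import Literature.NumberTheory.Automorphic.AutomorphicTwistHecke
import Literature.NumberTheory.Automorphic.BookerKrishnamurthyConverse
import Literature.NumberTheory.Automorphic.AdeleBaseChange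
import Literature.NumberTheory.GaloisRepresentations.GlobalArtinMapNormProofs

/-!
# Abbreviations for the split of the member statement — stub `stub_package` / sub-stub `pkg_member`
# of line `one-transparent-pane` (crux `Summit.Langlands.Langlands.Theses.QuadraticWindow.HostInducedRep`,
# item stmt-Langlands-10902)

Route-posited vocabulary only (`Prop`-valued abbreviations, no mathematics is asserted): the ledger cuts
registered stub signatures at 3900 characters, and the member statement of the line (for ONE CM
quadratic `K/F₀`: a cuspidal `τ'` on `GL_{2n}/K` with a `C`-algebraic weakly regular infinity type,
conjugate self-dual, of standard Asai sign, an algebraic `ψ₁`, and the Satake → host-polynomial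
dictionary) is split into six registered sub-stubs along its mathematical seams —
TOWER (the biquadratic field `L = F·K` and `s = τ̃ c̃`), SATAKE (all finite-place constructions:
`Π = AI(π ⊗ ψ)`, `Π_K = BC(Π)`, `ψ₀`, `τ' = Π_K ⊗ ψ₀`, `P = BC_{L/F}(π ⊗ ψ) ⊗ ψ₀∘N`, dictionary,
conjugate self-dualities, `τ' = AI_{L/K}(P)`), ARCH (infinity type of `τ'`), PANE-ARCH (archimedean
parameter of `P` at the panes), PARITY (Galois-side signs `det e(c_v)` versus the real components of
the Hecke characters, class field theory at the real places), SIGN (pure logic: the sign pin, the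
pane law, the `e ↔ e ω_{F/F₀}` / `ξ ∈ {1, ω_K}` switches) — whose interfaces are the predicates below.

* `MemberDict`, `MemberPkg` — the dictionary clauses and the full member conclusion (the hypothesis
  `hmember` of the family assembly `stub_package_of_member`);
* `MuHyp` — the admissible sign-twisting characters `μ` of `F₀` (`1, ω_K, ω_F, ω_K ω_F` qualify):
  finite order, `μ(ϖ_v) = ±1` a.e., `= 1` at the places split in both `K` and `F`;
* `IsPaneTower` — the biquadratic tower `F₀ ⊂ F, K ⊂ L ⊃ F'` with the involution `s` of `L/F'`
  restricting to `τ` on `F` and to `cK` on `K`, linear disjointness, and the pane property (`s` is the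
  complex conjugation of every embedding of `L` that is not real on `F`);
* `MemberRel` — the defining relations of the member objects (Artin avatars `χe, ω` of `e, eψ`, the
  restriction `ω₀ = ω|_{F₀}`, the unitary extension `ψu` of `χ₀ = (χe ω₀)⁻¹ μ` to `K`, the norm powers
  `νk = ‖·‖^{k/2}`, `ν = ‖·‖^{-n/2}`, `Π`, `Π_K`, `τ'`, `P₀ = BC_{L/F}(π ⊗ ω)`, `P`);
* `SatakeOut`, `ArchOut`, `PaneArchOut`, `ParityOut` — the conclusions of the SATAKE, ARCH,
  PANE-ARCH and PARITY sub-stubs;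
(The statements consumed by SIGN — existence of Asai signs, the sign pin `stub_signPin`, the pane
law `stub_paneLaw` — are spelled out inline in its registered signature: closed `Prop` definitions
would be named facts, which they are not.)
[folklore]
-/

open scoped BigOperators Polynomial Classical
open Filter Polynomial IsDedekindDomain NumberField
open Literature.NumberTheory.Automorphic Literature.NumberTheory.GaloisRepresentations
open Summit.Langlands.Langlands.Theorems.HostInducedRep.GrsExplicitDescent

-- `Summit.Langlands.Langlands.…` (summit = sub-problem name, D-0017 layout) trips `dupNamespace`.
set_option linter.dupNamespace false

noncomputable section

namespace Summit.Langlands.Langlands.Theorems.HostInducedRep.OneTransparentPane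

section Member

variable (F₀ : Type) {F : Type} [Field F₀] [NumberField F₀] [Field F] [NumberField F] [Algebra F₀ F]

/-- **The dictionary clauses of a member** `K`: at all but finitely many places `u` of `K` over a
guarded `v`, `ψ₁` is unramified at `u` and `τ'` has a Satake parameter `β` at `u` with
`arithFrobPolyOfSatake ι q_u (2n) (β ψ₁(ϖ_u)⁻¹) = ∏_{x root of hostPoly v} (X - x^{f(u∣v)})` (powers
form); and at ONE place over every guarded `v` split in `K`, the same with `= hostPoly v`.  Names a
statement; asserts nothing. [folklore] -/
def MemberDict {n : ℕ} {hcpt : isCompact_glFiniteIntegralLevel n F}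
    (π : CuspidalAutomorphicRepData n F hcpt) {ℓ : ℕ} [Fact ℓ.Prime] (ι : PadicAlgCl ℓ ≃+* ℂ)
    (eψ : FramedGaloisRep F ℂ 1) {K : Type} [Field K] [NumberField K] [Algebra F₀ K]
    {hK : isCompact_glFiniteIntegralLevel (2 * n) K}
    (τ' : AutomorphicRepData (AutomorphyDatum.gl (2 * n) K hK)) (ψ₁ : HeckeCharacter K) : Prop :=
  (∀ᶠ u : HeightOneSpectrum (𝓞 K) in cofinite,
    ∀ (v : HeightOneSpectrum (𝓞 F₀)) (α : HeightOneSpectrum (𝓞 F) → Multiset ℂ)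
      (c : HeightOneSpectrum (𝓞 F) → ℂ), u.under (𝓞 F₀) = v → Guard π eψ v α c →
      ψ₁.IsUnramifiedAt u ∧ ∃ β : Multiset ℂ, τ'.HasSatakeParamAt u β ∧
        arithFrobPolyOfSatake ι u.residueCard (2 * n)
            (β.map (fun b ↦ b * (ψ₁.valueAtUniformizer u)⁻¹)) =
          ((hostPoly ι n α c v).roots.map
            (fun x ↦ X - C (x ^ u.asIdeal.inertiaDeg (𝓞 F₀)))).prod) ∧
  (∀ (v : HeightOneSpectrum (𝓞 F₀)) (α : HeightOneSpectrum (𝓞 F) → Multiset ℂ)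
      (c : HeightOneSpectrum (𝓞 F) → ℂ), Guard π eψ v α c →
      (v.asIdeal.primesOver (𝓞 K)).ncard = 2 →
      ∃ u : HeightOneSpectrum (𝓞 K), u.under (𝓞 F₀) = v ∧ ψ₁.IsUnramifiedAt u ∧
        ∃ β : Multiset ℂ, τ'.HasSatakeParamAt u β ∧
          arithFrobPolyOfSatake ι u.residueCard (2 * n)
              (β.map (fun b ↦ b * (ψ₁.valueAtUniformizer u)⁻¹)) = hostPoly ι n α c v)

/-- **The member conclusion** for a CM quadratic `K/F₀` (the hypothesis `hmember` of the family
assembly `stub_package_of_member`): a level structure, a cuspidal `τ'` on `GL_{2n}/K`, an infinity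
type `T` and a Hecke character `ψ₁` with the six properties consumed by `stub_galoisOverK`
(`HasInfinityType`, `IsCAlgebraic`, `IsWeaklyRegular`, conjugate self-duality a.e. and standard Asai
sign w.r.t. `complexConj K`, `ψ₁` algebraic) and the dictionary `MemberDict`.  Names a statement;
asserts nothing. [folklore] -/
def MemberPkg {n : ℕ} {hcpt : isCompact_glFiniteIntegralLevel n F}
    (π : CuspidalAutomorphicRepData n F hcpt) {ℓ : ℕ} [Fact ℓ.Prime] (ι : PadicAlgCl ℓ ≃+* ℂ)
    (eψ : FramedGaloisRep F ℂ 1) (K : Type) [Field K] [NumberField K] [Algebra F₀ K]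
    [IsCMField K] : Prop :=
  ∃ (hK : isCompact_glFiniteIntegralLevel (2 * n) K) (τ' : CuspidalAutomorphicRepData (2 * n) K hK)
    (T : InfinityType K (2 * n)) (ψ₁ : HeckeCharacter K),
    τ'.1.HasInfinityType T ∧ T.IsCAlgebraic ∧ T.IsWeaklyRegular ∧
    τ'.1.IsConjSelfDualAE (IsCMField.complexConj K) ∧
    τ'.1.HasAsaiSign (IsCMField.complexConj K) 1 ∧ ψ₁.IsAlgebraic ∧ MemberDict F₀ π ι eψ τ'.1 ψ₁

variable {F₀}

/-- **Admissible sign-twisting characters** `μ` of `F₀` relative to the two quadratic extensions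
`F`, `K`: finite order, and almost everywhere unramified with `μ(ϖ_v)² = 1` and `μ(ϖ_v) = 1` at the
places split in both `K` and `F`.  The trivial character, the quadratic characters `ω_{K/F₀}`,
`ω_{F/F₀}` and their product qualify.  Names a statement; asserts nothing. [folklore] -/
def MuHyp (F K : Type) [Field F] [NumberField F] [Algebra F₀ F] [Field K] [NumberField K]
    [Algebra F₀ K] (μ : HeckeCharacter F₀) : Prop :=
  μ.IsFiniteOrder ∧ ∀ᶠ v : HeightOneSpectrum (𝓞 F₀) in cofinite,
    μ.IsUnramifiedAt v ∧ μ.valueAtUniformizer v ^ 2 = 1 ∧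
      ((v.asIdeal.primesOver (𝓞 K)).ncard = 2 → (v.asIdeal.primesOver (𝓞 F)).ncard = 2 →
        μ.valueAtUniformizer v = 1)

/-- **The biquadratic pane tower.**  `F/F₀` (involution `τ`) and `K/F₀` (involution `cK`) inside
`L` (of degree `2` over each of `F`, `K` and over a fourth field `F'` with involution `s` of `L/F'`):
`s` restricts to `cK` on `K` and to `τ` on `F` (so `s = τ̃ c̃` and `F' = L^s` is the third quadratic
subfield), `F ∩ K = F₀` inside `L`, and the PANE property: `s` is the complex conjugation of every
complex embedding of `L` whose restriction to `F` is not real (the places of `L` over the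
complex-type real places of `F₀`).  Names a statement; asserts nothing. [folklore] -/
def IsPaneTower {K : Type} [Field K] [Algebra F₀ K] (τ : F ≃ₐ[F₀] F) (cK : K ≃ₐ[F₀] K)
    (L F' : Type) [Field L] [Field F'] [Algebra F₀ L] [Algebra F L] [Algebra K L] [Algebra F' L]
    (s : L ≃ₐ[F'] L) : Prop :=
  Module.finrank F L = 2 ∧ Module.finrank K L = 2 ∧ Module.finrank F' L = 2 ∧ s ≠ 1 ∧
  (∀ x : K, s (algebraMap K L x) = algebraMap K L (cK x)) ∧
  (∀ x : F, s (algebraMap F L x) = algebraMap F L (τ x)) ∧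
  (∀ (x : F) (y : K), algebraMap F L x = algebraMap K L y → ∃ z : F₀, x = algebraMap F₀ F z) ∧
  (∀ σ : L →+* ℂ, ¬ ComplexEmbedding.IsReal (σ.comp (algebraMap F L)) →
    ComplexEmbedding.IsConj σ s)

/-- **The defining relations of the member objects** (parameter `μ`; objects `χe, ω, ω₀` over
`F₀, F, F₀`, `ψu, νk, ν` over `K`, `Pind = Π` on `GL_{2n}/F₀`, `PiK = Π_K, τ'` on `GL_{2n}/K`, `P₀, P` on
`GL_n/L`): `χe` and `ω` are the finite-order Hecke characters of the Artin avatars `e` and `eψ`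
(Artin reciprocity, Frobenius compatibility wherever the avatar is unramified), `ω₀ = ω|_{𝔸_{F₀}}`,
`χ₀ := (χe ω₀)⁻¹ μ` has finite order, `ψu` is a UNITARY Hecke character of `K` restricting to `χ₀` on
`𝔸_{F₀}^×`, `νk = ‖·‖_K^{k/2}`, `ν = ‖·‖_K^{-n/2}`, `Π` is a weak automorphic induction of `π ⊗ ω`,
`PiK` a weak base change of `Π` to `K`, `τ' = PiK ⊗ (ψ₀ ∘ det)` with `ψ₀ = ψu νk` (twisted datum),
`P₀` a weak base change of `π ⊗ ω` to `L`, and `P = P₀ ⊗ ((ψ₀ ∘ N_{L/K}) ∘ det)`.  Names a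
statement; asserts nothing. [folklore] -/
def MemberRel {n : ℕ} {hcpt : isCompact_glFiniteIntegralLevel n F}
    (π : CuspidalAutomorphicRepData n F hcpt) (e : FramedGaloisRep F₀ ℂ 1)
    (eψ : FramedGaloisRep F ℂ 1) (k : ℤ) {K L : Type} [Field K] [NumberField K] [Algebra F₀ K]
    [Field L] [NumberField L] [Algebra F L] [Algebra K L] [IsGalois K L]
    (μ χe : HeckeCharacter F₀) (ω : HeckeCharacter F) (hfin : ω.IsFiniteOrder)
    (ω₀ : HeckeCharacter F₀) (ψu νk ν : HeckeCharacter K)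
    (Pind : CuspidalAutomorphicRepData (2 * n) F₀ (isCompact_glFiniteIntegralLevel_holds (2 * n) F₀))
    (PiK τ' : CuspidalAutomorphicRepData (2 * n) K (isCompact_glFiniteIntegralLevel_holds (2 * n) K))
    (P₀ P : CuspidalAutomorphicRepData n L (isCompact_glFiniteIntegralLevel_holds n L)) : Prop :=
  (∀ v : HeightOneSpectrum (𝓞 F₀), e.IsUnramifiedAt v →
      χe.IsUnramifiedAt v ∧ e.HasFrobCharpolyAt v (X - C (χe.valueAtUniformizer v))) ∧
  χe.IsFiniteOrder ∧
  (∀ w : HeightOneSpectrum (𝓞 F), eψ.IsUnramifiedAt w →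
      ω.IsUnramifiedAt w ∧ eψ.HasFrobCharpolyAt w (X - C (ω.valueAtUniformizer w))) ∧
  (∀ x, ω₀ x = ω (AdeleRing.ideleBaseChange F₀ F x)) ∧
  ((χe * ω₀)⁻¹ * μ).IsFiniteOrder ∧ ψu.IsUnitary ∧
  (∀ x, ψu (AdeleRing.ideleBaseChange F₀ K x) = ((χe * ω₀)⁻¹ * μ) x) ∧
  (∀ x : ideleGroup K, ((νk x : ℂˣ) : ℂ) = ((ideleNorm x : ℝ) : ℂ) ^ ((k : ℂ) / 2)) ∧
  (∀ x : ideleGroup K, ((ν x : ℂˣ) : ℂ) = ((ideleNorm x : ℝ) : ℂ) ^ (-(n : ℂ) / 2)) ∧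
  IsAutomorphicInductionAlong (π.twist ω hfin).1 Pind.1 ∧ IsWeakBaseChangeLiftAE Pind.1 PiK.1 ∧
  τ'.1.W = PiK.1.W.map (mulChar (detTwist (2 * n) (ψu * νk))) ∧
  τ'.1.W' = PiK.1.W'.map (mulChar (detTwist (2 * n) (ψu * νk))) ∧
  IsWeakBaseChangeLiftAE (π.twist ω hfin).1 P₀.1 ∧
  P.1.W = P₀.1.W.map (mulChar (detTwist n ((ψu * νk).compRelNorm L))) ∧
  P.1.W' = P₀.1.W'.map (mulChar (detTwist n ((ψu * νk).compRelNorm L)))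

variable (F₀) in
/-- **Conclusion of the SATAKE sub-stub**: the dictionary `MemberDict` for `(τ', ψ₁)`, conjugate
self-duality a.e. of `τ'` w.r.t. `cK` and of `P` w.r.t. `s`, and `τ'` is a weak automorphic induction
of `P` along `L/K`.  Names a statement; asserts nothing. [folklore] -/
def SatakeOut {n : ℕ} {hcpt : isCompact_glFiniteIntegralLevel n F}
    (π : CuspidalAutomorphicRepData n F hcpt) {ℓ : ℕ} [Fact ℓ.Prime] (ι : PadicAlgCl ℓ ≃+* ℂ)
    (eψ : FramedGaloisRep F ℂ 1) {K L F' : Type} [Field K] [NumberField K] [Algebra F₀ K]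
    [Field L] [NumberField L] [Algebra K L] [Field F'] [Algebra F' L]
    (cK : K ≃ₐ[F₀] K) (s : L ≃ₐ[F'] L) {hK : isCompact_glFiniteIntegralLevel (2 * n) K}
    (τ' : AutomorphicRepData (AutomorphyDatum.gl (2 * n) K hK)) (ψ₁ : HeckeCharacter K)
    {hL : isCompact_glFiniteIntegralLevel n L} (P : AutomorphicRepData (AutomorphyDatum.gl n L hL)) :
    Prop :=
  MemberDict F₀ π ι eψ τ' ψ₁ ∧ τ'.IsConjSelfDualAE cK ∧ P.IsConjSelfDualAE s ∧
    IsAutomorphicInductionAlong P τ'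

/-- **Conclusion of the ARCH sub-stub** (for an infinity type `T` of `τ'` on `GL_{2n}/K`): `τ'` has
infinity type `T`, `T` is weakly regular, and the TYPE-I CRITERION: if the real components of
`χ₀ = ψu|_{𝔸_{F₀}}` at every real place of `F₀` take the value `(-1)^{n+k}` at `-1`, then `T` is
`C`-algebraic and `ψ₁` is algebraic.  Names a statement; asserts nothing. [folklore] -/
def ArchOut {n : ℕ} (k : ℤ) {K : Type} [Field K] [NumberField K] (χ₀ : HeckeCharacter F₀)
    {hK : isCompact_glFiniteIntegralLevel (2 * n) K}
    (τ' : AutomorphicRepData (AutomorphyDatum.gl (2 * n) K hK)) (ψ₁ : HeckeCharacter K)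
    (T : InfinityType K (2 * n)) : Prop :=
  τ'.HasInfinityType T ∧ T.IsWeaklyRegular ∧
    ((∀ v : InfinitePlace F₀, ((χ₀.archComponent v (-1) : ℂˣ) : ℂ) = (-1 : ℂ) ^ ((n : ℤ) + k)) →
      T.IsCAlgebraic ∧ ψ₁.IsAlgebraic)

/-- **Conclusion of the PANE-ARCH sub-stub** (for an archimedean parameter `χ` of `P` on
`GL_n/L`): `P` has archimedean parameter `χ`, and at EVERY complex embedding `σ` of `L` the exponents
`χ σ` are multiplicity free, `n` in number, and lie in the single coset `(n-1)/2 + (m+k)/2 + ℤ` for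
an integer `m` with `(-1)^m` the value at `-1` of the real component of `χ₀` at the place of `F₀`
below `σ`.  Names a statement; asserts nothing. [folklore] -/
def PaneArchOut (n : ℕ) (k : ℤ) {L : Type} [Field L] [NumberField L] [Algebra F₀ L]
    (χ₀ : HeckeCharacter F₀) {hL : isCompact_glFiniteIntegralLevel n L}
    (P : AutomorphicRepData (AutomorphyDatum.gl n L hL)) (χ : (L →+* ℂ) → Multiset ℂ) : Prop :=
  P.HasArchParameter χ ∧ ∀ σ : L →+* ℂ, (χ σ).Nodup ∧ Multiset.card (χ σ) = n ∧
    ∃ m : ℤ, ((χ₀.archComponent (InfinitePlace.mk (σ.comp (algebraMap F₀ L))) (-1) : ℂˣ) : ℂ) =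
        (-1 : ℂ) ^ m ∧
      ∀ a ∈ χ σ, ∃ j : ℤ, a = (j : ℂ) + ((n : ℂ) - 1) / 2 + ((m : ℂ) + k) / 2

/-- **Conclusion of the PARITY sub-stub** (for `θ = χe ω₀`, the Hecke-side polarization sign
character): the real components of `θ` at `-1` agree at any two real places of `F₀` below REAL
places of `F` (the crux's `hpar`, read through class field theory at the real places), and the
quadratic characters `μK = ω_{K/F₀}`, `μF = ω_{F/F₀}` exist as admissible sign-twisting characters
(`MuHyp`, also for their product) with real components `μK,v(-1) = -1` everywhere and
`μF,v(-1) = -1` exactly below the complex places of `F`.  Names a statement; asserts nothing.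
[folklore] -/
def ParityOut (F K : Type) [Field F] [NumberField F] [Algebra F₀ F] [Field K] [NumberField K]
    [Algebra F₀ K] (θ : HeckeCharacter F₀) : Prop :=
  (∀ w w' : InfinitePlace F, w.IsReal → w'.IsReal →
      θ.archComponent (w.comap (algebraMap F₀ F)) (-1) =
        θ.archComponent (w'.comap (algebraMap F₀ F)) (-1)) ∧
  ∃ μK μF : HeckeCharacter F₀, MuHyp F K μK ∧ MuHyp F K μF ∧ MuHyp F K (μK * μF) ∧
    (∀ v : InfinitePlace F₀, μK.archComponent v (-1) = -1) ∧
    (∀ w : InfinitePlace F, μF.archComponent (w.comap (algebraMap F₀ F)) (-1) =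
      if w.IsReal then 1 else -1)

end Member


/-- **Registered anchor** of this definitions file (stub registry of stmt-Langlands-10902, line
`one-transparent-pane`): an admissible sign-twisting character has finite order. [folklore] -/
theorem paneDefs_anchor : ∀ (F₀ F K : Type) [Field F₀] [NumberField F₀] [Field F] [NumberField F] [Algebra F₀ F] [Field K] [NumberField K] [Algebra F₀ K] (μ : HeckeCharacter F₀), MuHyp F K μ → μ.IsFiniteOrder :=
  fun _ _ _ _ _ _ _ _ _ _ _ _ h ↦ h.1

end Summit.Langlands.Langlands.Theorems.HostInducedRep.OneTransparentPane

end
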